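import Mathlib
import Summits.Ventures.HodgeRepro2.T5ProfiniteCharacterExtension
import Summits.Ventures.HodgeRepro2.T5ValuedBallBasis
import Summits.Ventures.HodgeRepro2.T5AdicCompletionRamified

/-!
# The higher unit groups are open in `Kvˣ`: characters trivial on `U^n` are continuous

The characters of `E_v^×` produced by the (A10)-type statements (`T5ConductorExistenceInflated`
at an inert place, `T5RamifiedCharacterInflation` / `T5AdicCompletionRamified` at a ramified
place) are abstract homomorphisms `Lˣ →* ℂˣ` trivial on a higher unit group `U_E^{n}`; the
prose calls them characters, i.e. CONTINUOUS homomorphisms. This file closes the gap on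
Mathlib's completions `Kv := v.adicCompletion K` (any Dedekind domain `R` with fraction field
`K`, `v` a height-one prime): for a uniformiser `π` of `O_{Kv}` and `n ≥ 1`,

* `mem_map_higherUnits_iff`: the image of `U^n = higherUnits π n` in `Kvˣ` is the set of units
  `x` with `v(x − 1) ≤ exp(−n)` (the prose's «`U_E^n = 1 + P_E^n`»);
* `isOpen_map_higherUnits`: this subgroup of `Kvˣ` is OPEN (the ball of `T5ValuedBallBasis`
  pulled back along the continuous `Units.val` and `x ↦ x − 1`);
* `continuous_of_eq_one_on_higherUnits`: every homomorphism `Kvˣ →* M` into a topological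
  monoid that is trivial on the image of `U^n` is continuous
  (`T5ProfiniteCharacterExtension.continuous_of_eq_one_on_open_subgroup`);
* on the concrete quadratic pair at a ramified place,
  `exists_continuous_character_trivial_on_exact_even_level_of_quadratic_ramified`: the
  characters of `T5AdicCompletionRamified` are continuous — «conjugate-orthogonal CHARACTERS of
  every even exact conductor exist at a ramified place», with continuity.

Declaration per README §8(d): «uses an L-value-free non-vanishing device: NO».
-/

namespace Summit.Ventures.HodgeRepro2.T5OpenUnitsLevel

open T5PrincipalUnitFiltration T5PrincipalUnitComparison IsDedekindDomain HeightOneSpectrum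

section General

variable {R : Type*} [CommRing R] [IsDedekindDomain R] {K : Type*} [Field K] [Algebra R K]
  [IsFractionRing R K] (v : HeightOneSpectrum R)


/-- `exp(−1)^n = exp(−n)` in `ℤᵐ⁰`. -/
theorem exp_neg_one_pow (n : ℕ) :
    (WithZero.exp (-1 : ℤ)) ^ n = WithZero.exp (-(n : ℤ)) := by
  rw [← WithZero.exp_nsmul]
  congr 1
  simp

/-- The valuation of `x − 1` for `x` in the image of `U^n`: `v(x − 1) ≤ exp(−n)`. -/
theorem val_sub_one_le_of_mem_higherUnits {π : (adicCompletionIntegers K v)} (hπ : Irreducible π) {n : ℕ} {s : (adicCompletionIntegers K v)ˣ}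
    (hs : s ∈ higherUnits π n) :
    Valued.v (((Units.map (algebraMap (adicCompletionIntegers K v) (adicCompletion K v) : adicCompletionIntegers K v →* adicCompletion K v) s : (adicCompletion K v)ˣ) : adicCompletion K v) - 1) ≤
      WithZero.exp (-(n : ℤ)) := by
  rw [mem_higherUnits] at hs
  obtain ⟨c, hc⟩ := hs
  have e : ((Units.map (algebraMap (adicCompletionIntegers K v) (adicCompletion K v) : adicCompletionIntegers K v →* adicCompletion K v) s : (adicCompletion K v)ˣ) : adicCompletion K v) - 1 =
      algebraMap (adicCompletionIntegers K v) (adicCompletion K v) ((s : (adicCompletionIntegers K v)) - 1) := by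
    rw [map_sub, map_one]; rfl
  have hv : Valued.v (algebraMap (adicCompletionIntegers K v) (adicCompletion K v) π) = WithZero.exp (-1 : ℤ) :=
    (T5AdicCompletionConductor.irreducible_iff_val_eq_exp_neg_one v π).1 hπ
  rw [e, hc, map_mul, map_pow, Valuation.map_mul, Valuation.map_pow, hv, exp_neg_one_pow]
  calc WithZero.exp (-(n : ℤ)) * Valued.v (algebraMap (adicCompletionIntegers K v) (adicCompletion K v) c)
      ≤ WithZero.exp (-(n : ℤ)) * 1 :=
        mul_le_mul_right ((mem_adicCompletionIntegers R K v).1 c.2) _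
    _ = WithZero.exp (-(n : ℤ)) := mul_one _

/-- The image of `U^n` (`n ≥ 1`) in `Kvˣ` is exactly the set of units `x` with
`v(x − 1) ≤ exp(−n)`: such an `x` has `v x = 1`, so it is an integral unit, and the
divisibility `π^n ∣ x − 1` is the valuation inequality (`Valuation.Integers.le_iff_dvd`). -/
theorem mem_map_higherUnits_iff {π : (adicCompletionIntegers K v)} (hπ : Irreducible π) {n : ℕ} (hn : 1 ≤ n)
    (x : (adicCompletion K v)ˣ) :
    x ∈ (higherUnits π n).map (Units.map (algebraMap (adicCompletionIntegers K v) (adicCompletion K v) : adicCompletionIntegers K v →* adicCompletion K v)) ↔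
      Valued.v ((x : adicCompletion K v) - 1) ≤ WithZero.exp (-(n : ℤ)) := by
  constructor
  · rintro ⟨s, hs, rfl⟩
    exact val_sub_one_le_of_mem_higherUnits v hπ hs
  · intro hx
    have hlt : Valued.v ((x : adicCompletion K v) - 1) < 1 := by
      refine lt_of_le_of_lt hx ?_
      rw [← WithZero.exp_zero, WithZero.exp_lt_exp]
      omega
    have hx1 : Valued.v (x : adicCompletion K v) = 1 := by
      have := Valuation.map_one_add_of_lt Valued.v hlt
      rwa [add_sub_cancel] at this
    have hxmem : (x : adicCompletion K v) ∈ (adicCompletionIntegers K v) := (mem_adicCompletionIntegers R K v).2 hx1.le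
    have hxinv : ((x⁻¹ : (adicCompletion K v)ˣ) : adicCompletion K v) ∈ (adicCompletionIntegers K v) := by
      rw [mem_adicCompletionIntegers, Units.val_inv_eq_inv_val, Valuation.map_inv, hx1, inv_one]
    let s : (adicCompletionIntegers K v)ˣ := ⟨⟨(x : adicCompletion K v), hxmem⟩, ⟨((x⁻¹ : (adicCompletion K v)ˣ) :
      adicCompletion K v), hxinv⟩, Subtype.ext (by simp), Subtype.ext (by simp)⟩
    refine ⟨s, ?_, Units.ext rfl⟩
    show s ∈ higherUnits π n
    rw [mem_higherUnits]
    have hv : Valued.v (algebraMap (adicCompletionIntegers K v) (adicCompletion K v) π) = WithZero.exp (-1 : ℤ) :=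
      (T5AdicCompletionConductor.irreducible_iff_val_eq_exp_neg_one v π).1 hπ
    have hle : Valued.v (algebraMap (adicCompletionIntegers K v) (adicCompletion K v) ((s : (adicCompletionIntegers K v)) - 1)) ≤
        Valued.v (algebraMap (adicCompletionIntegers K v) (adicCompletion K v) (π ^ n)) := by
      rw [map_sub, map_one, map_pow, Valuation.map_pow, hv, exp_neg_one_pow]
      exact hx
    exact ((adicCompletionIntegers.integers K v).le_iff_dvd).1 hle

/-- The image of `U^n` (`n ≥ 1`) is an OPEN subgroup of `Kvˣ`. -/
theorem isOpen_map_higherUnits {π : (adicCompletionIntegers K v)} (hπ : Irreducible π) {n : ℕ} (hn : 1 ≤ n) :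
    IsOpen (((higherUnits π n).map (Units.map (algebraMap (adicCompletionIntegers K v) (adicCompletion K v) : adicCompletionIntegers K v →* adicCompletion K v)) : Subgroup (adicCompletion K v)ˣ) :
      Set (adicCompletion K v)ˣ) := by
  have e : (((higherUnits π n).map (Units.map (algebraMap (adicCompletionIntegers K v) (adicCompletion K v) : adicCompletionIntegers K v →* adicCompletion K v)) : Subgroup (adicCompletion K v)ˣ) :
      Set (adicCompletion K v)ˣ) =
      (fun x : (adicCompletion K v)ˣ => (x : adicCompletion K v) - 1) ⁻¹'
        {y : adicCompletion K v | Valued.v y ≤ WithZero.exp (-(n : ℤ))} := by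
    ext x
    exact mem_map_higherUnits_iff v hπ hn x
  rw [e]
  exact (T5ValuedBallBasis.isOpen_ball _).preimage (Units.continuous_val.sub continuous_const)

/-- A homomorphism `Kvˣ →* M` trivial on the image of `U^n` (`n ≥ 1`) is continuous. -/
theorem continuous_of_eq_one_on_higherUnits {M : Type*} [MulOneClass M] [TopologicalSpace M]
    [ContinuousMul M] {π : (adicCompletionIntegers K v)} (hπ : Irreducible π) {n : ℕ} (hn : 1 ≤ n)
    (χ : (adicCompletion K v)ˣ →* M) (h : ∀ s ∈ higherUnits π n, χ (Units.map (algebraMap (adicCompletionIntegers K v) (adicCompletion K v) : adicCompletionIntegers K v →* adicCompletion K v) s) = 1) :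
    Continuous χ :=
  T5ProfiniteCharacterExtension.continuous_of_eq_one_on_open_subgroup χ _
    (isOpen_map_higherUnits v hπ hn) (by
      rintro _ ⟨s, hs, rfl⟩
      exact h s hs)

end General

section Concrete

variable {K : Type*} [Field K] [NumberField K] (v : HeightOneSpectrum (NumberField.RingOfIntegers K))
variable {L : Type*} [Field L] [NumberField L] [Algebra K L]
  (w : HeightOneSpectrum (NumberField.RingOfIntegers L))
variable [Algebra (adicCompletion K v) (adicCompletion L w)]
  [ContinuousSMul (adicCompletion K v) (adicCompletion L w)]
  [IsScalarTower K (adicCompletion K v) (adicCompletion L w)]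


/-- At a RAMIFIED quadratic place of Mathlib's completions, for every `k` there is a CONTINUOUS
character of `Lwˣ` trivial on `F` («`F_v^×`») and on `U_E^{2k+2}` and non-trivial on
`U_E^{2k+1}` — `T5AdicCompletionRamified.exists_character_trivial_on_exact_even_level_of_quadratic_ramified`
with continuity. -/
theorem exists_continuous_character_trivial_on_exact_even_level_of_quadratic_ramified
    (hfin : Module.finrank (adicCompletion K v) (adicCompletion L w) = 2)
    {ϖ : (adicCompletionIntegers K v)} (hϖ : Irreducible ϖ) {π : (adicCompletionIntegers L w)} (hπ : Irreducible π)
    (hram : ¬ Irreducible (algebraMap (adicCompletionIntegers K v) (adicCompletionIntegers L w) ϖ)) (F : Subgroup (adicCompletion L w)ˣ)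
    (hF : ∀ s : (adicCompletionIntegers L w)ˣ, Units.map (algebraMap (adicCompletionIntegers L w) (adicCompletion L w) : (adicCompletionIntegers L w) →* adicCompletion L w) s ∈ F →
      ∃ r : (adicCompletionIntegers K v)ˣ, s = unitsMap r) (k : ℕ) :
    ∃ χ' : (adicCompletion L w)ˣ →* ℂˣ, Continuous χ' ∧ (∀ f ∈ F, χ' f = 1) ∧
      (∀ y ∈ higherUnits π (2 * k + 2),
        χ' (Units.map (algebraMap (adicCompletionIntegers L w) (adicCompletion L w) : (adicCompletionIntegers L w) →* adicCompletion L w) y) = 1) ∧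
      ∃ y ∈ higherUnits π (2 * k + 1),
        χ' (Units.map (algebraMap (adicCompletionIntegers L w) (adicCompletion L w) : (adicCompletionIntegers L w) →* adicCompletion L w) y) ≠ 1 := by
  obtain ⟨χ', h1, h2, h3⟩ :=
    T5AdicCompletionRamified.exists_character_trivial_on_exact_even_level_of_quadratic_ramified
      v w hfin hϖ hπ hram F hF k
  exact ⟨χ', continuous_of_eq_one_on_higherUnits w hπ (by omega) χ' h2, h1, h2, h3⟩

/-- The higher unit groups do not depend on the choice of uniformiser (two irreducibles of a
discrete valuation ring are associated). -/
theorem higherUnits_eq_of_irreducible {S : Type*} [CommRing S] [IsDomain S]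
    [IsDiscreteValuationRing S] {ϖ' π : S} (hϖ' : Irreducible ϖ') (hπ : Irreducible π) (n : ℕ) :
    higherUnits ϖ' n = higherUnits π n := by
  ext y
  rw [mem_higherUnits, mem_higherUnits]
  exact ((IsDiscreteValuationRing.associated_of_irreducible S hϖ' hπ).pow_pow).dvd_iff_dvd_left

/-- At a quadratic INERT place of Mathlib's completions (`ϖ_K` stays a uniformiser), for every
`n ≥ 1` there is a CONTINUOUS character of `Lwˣ` trivial on `F` («`F_v^×`») and on `U_E^{n+1}`
and non-trivial on `U_E^n` — `T5AdicCompletionInert.exists_character_exact_level_of_quadratic_inert`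
inflated to `Lwˣ` (gluing lemma of `T5RamifiedCharacterInflation`), with continuity. -/
theorem exists_continuous_character_trivial_on_exact_level_of_quadratic_inert
    (hfin : Module.finrank (adicCompletion K v) (adicCompletion L w) = 2)
    {ϖ : (adicCompletionIntegers K v)} (hϖ : Irreducible ϖ)
    (hϖL : Irreducible (algebraMap (adicCompletionIntegers K v) (adicCompletionIntegers L w) ϖ))
    (F : Subgroup (adicCompletion L w)ˣ)
    (hF : ∀ s : (adicCompletionIntegers L w)ˣ, Units.map (algebraMap (adicCompletionIntegers L w)
      (adicCompletion L w) : (adicCompletionIntegers L w) →* adicCompletion L w) s ∈ F →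
      ∃ r : (adicCompletionIntegers K v)ˣ, s = unitsMap r) {n : ℕ} (hn : 1 ≤ n) :
    ∃ χ' : (adicCompletion L w)ˣ →* ℂˣ, Continuous χ' ∧ (∀ f ∈ F, χ' f = 1) ∧
      (∀ y ∈ higherUnits (algebraMap (adicCompletionIntegers K v) (adicCompletionIntegers L w) ϖ)
        (n + 1), χ' (Units.map (algebraMap (adicCompletionIntegers L w) (adicCompletion L w) :
          (adicCompletionIntegers L w) →* adicCompletion L w) y) = 1) ∧
      ∃ y ∈ higherUnits (algebraMap (adicCompletionIntegers K v) (adicCompletionIntegers L w) ϖ) n,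
        χ' (Units.map (algebraMap (adicCompletionIntegers L w) (adicCompletion L w) :
          (adicCompletionIntegers L w) →* adicCompletion L w) y) ≠ 1 := by
  obtain ⟨χ, h1, h2, y, hy, hy'⟩ :=
    T5AdicCompletionInert.exists_character_exact_level_of_quadratic_inert v w hfin hϖ hϖL n
  obtain ⟨ψ, hψ1, hψ2⟩ := T5RamifiedCharacterInflation.exists_comp_eq_of_eq_one_on_preimage _
    (T5RamifiedCharacterInflation.unitsMapL_injective (S := adicCompletionIntegers L w)
      (L := adicCompletion L w)) F χ (fun s hs => by
      obtain ⟨r, rfl⟩ := hF s hs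
      exact h2 r)
  refine ⟨ψ, ?_, hψ2, fun z hz => by rw [hψ1]; exact h1 z hz, y, hy, by rw [hψ1]; exact hy'⟩
  exact continuous_of_eq_one_on_higherUnits w hϖL (n := n + 1) (by omega) ψ (fun z hz => by
    rw [hψ1]; exact h1 z hz)

/-- At EVERY quadratic place of Mathlib's completions (inert or ramified), for every `k` there is
a CONTINUOUS character of `Lwˣ` trivial on `F` («`F_v^×`») and on `U_E^{2k+2}` and non-trivial
on `U_E^{2k+1}`, `U_E^n` taken along any uniformiser `π` of `O_{Lw}` — the conjugate-orthogonal
characters of even exact conductor that Theorem N5.T2′ of §N5.12.2 uses at every non-split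
place. -/
theorem exists_continuous_character_trivial_on_of_quadratic
    (hfin : Module.finrank (adicCompletion K v) (adicCompletion L w) = 2)
    {ϖ : (adicCompletionIntegers K v)} (hϖ : Irreducible ϖ)
    {π : (adicCompletionIntegers L w)} (hπ : Irreducible π) (F : Subgroup (adicCompletion L w)ˣ)
    (hF : ∀ s : (adicCompletionIntegers L w)ˣ, Units.map (algebraMap (adicCompletionIntegers L w)
      (adicCompletion L w) : (adicCompletionIntegers L w) →* adicCompletion L w) s ∈ F →
      ∃ r : (adicCompletionIntegers K v)ˣ, s = unitsMap r) (k : ℕ) :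
    ∃ χ' : (adicCompletion L w)ˣ →* ℂˣ, Continuous χ' ∧ (∀ f ∈ F, χ' f = 1) ∧
      (∀ y ∈ higherUnits π (2 * k + 2),
        χ' (Units.map (algebraMap (adicCompletionIntegers L w) (adicCompletion L w) :
          (adicCompletionIntegers L w) →* adicCompletion L w) y) = 1) ∧
      ∃ y ∈ higherUnits π (2 * k + 1),
        χ' (Units.map (algebraMap (adicCompletionIntegers L w) (adicCompletion L w) :
          (adicCompletionIntegers L w) →* adicCompletion L w) y) ≠ 1 := by
  by_cases h : Irreducible (algebraMap (adicCompletionIntegers K v) (adicCompletionIntegers L w) ϖ)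
  · obtain ⟨χ', hc, h1, h2, h3⟩ :=
      exists_continuous_character_trivial_on_exact_level_of_quadratic_inert v w hfin hϖ h F hF
        (n := 2 * k + 1) (by omega)
    rw [higherUnits_eq_of_irreducible h hπ] at h2 h3
    exact ⟨χ', hc, h1, h2, h3⟩
  · exact exists_continuous_character_trivial_on_exact_even_level_of_quadratic_ramified v w hfin
      hϖ hπ h F hF k

end Concrete

end Summit.Ventures.HodgeRepro2.T5OpenUnitsLevel
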